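import Summits.BirchSwinnertonDyer.Rank1Residual.GaloisImage.PropagatedStructure
import Literature.NumberTheory.EllipticCurves.KummerSelmerStructure
import HarnessLib

/-!
# `𝓛_v(p^{k+1}) ≤ 𝓕_can(E[p^{k+1}])_v ≤ 𝓛_v(p^{k+1})` at EVERY level `k`: the local Kummer
# sandwich for the propagated canonical structure (cell `b2b-bsdres`, team n1011, row T-a3-F1 (B4);
# seat n1011-p05 gen 2, PROPOSED ROW T-a3-F1-B4 under R3-25 (f))

HONEST FRAMING (cell `b2b-bsdres`, run/shared/lean/b2b/bsd-rank1-residual/, verbatim in every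
file): the goal of the cell is to DELETE the COMBINATION-SHAPED residual classes of the
Birch–Swinnerton-Dyer formula for ALL analytic-rank `≤ 1` elliptic curves over `ℚ` — "full BSD
formula for every rank `≤ 1` curve in class `C`" assembled STRICTLY from published theorems — so
that the rank-`≤ 1` remainder becomes exactly the CONSTRUCTION-SHAPED classes, which are TYPED
(missing-input `Prop`s), NOT attempted. This is not "finishing BSD". Team n1011 (X4 ∧ `p = 3`,
§I N11; row T-a3-F1 = the hypothesis side of Sakamoto 2024 Thm. 4.4 for `(E[3^{k+1}], 𝓕_can)`):
research route; theorems only; no definition, no named fact; nothing booked; no label changes.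

## What and why

n1011-p13's N11 instance `kolyvaginSystems_freeRankOne_propagatedSelmerStructure`
(`GaloisImage/SakamotoN11Instance.lean`) carries the binder
`hunr : (propagatedSelmerStructure W 3 k).IsUnramifiedOutside S` ("binder (B4)",
skel/T-a3-F1-N11.md §3).  The tree has the LEVEL-ONE local comparison of the propagated canonical
structure `𝓕_can` with the local Kummer condition `𝓛_v`:
n1011-p18's `kummerSelmerStructure_le_propagatedSelmerStructureOne` (`𝓛_v(p) ≤ 𝓕_can(E[p])_v`,
every place, no hypothesis; `PropagatedConditionKummer.lean`) and n1011-p06's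
`propagatedSelmerStructureOne_le_kummerSelmerStructure_inr` (the reverse inclusion under the binder
hbd = "the `p`-power torsion of `H¹(ℚ_v, E(ℚ̄_v))` has bounded exponent", the (Lℓ) lemma;
`PropagatedStructureKummerEq.lean`).  This file proves the LEVEL-`k` siblings, for
`𝓕_can(E[p^{k+1}])_v = im(π_{k+1,*} : H¹(ℚ_v, T_pE) → H¹(ℚ_v, E[p^{k+1}]))`
(`propagatedSelmerStructure W p k v`, level spelled `p^k · p` as in p13's file) and the local Kummer
condition `𝓛_v(p^{k+1})` (`WeierstrassCurve.kummerSelmerStructure ((p:ℤ)^k * p)`), at EVERY place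
`v` of `ℚ`, every prime `p`, every `k`:

* (private helpers `localKummerClass_mem_propagatedSelmerStructure`,
  `kummerSelmerStructure_pow_mul_le_propagatedSelmerStructure` = p13's public
  `kummerSelmerStructure_le_propagatedSelmerStructure`) **`𝓛_v(p^{k+1}) ≤ 𝓕_can(E[p^{k+1}])_v`**, NO hypothesis — p18's `p`-adic Kummer lift with the
  root sequence SHIFTED: for `Q ∈ E(ℚ̄_v)` with `p^{k+1} Q ∈ E(ℚ_v)` choose `R_0 = Q`,
  `p R_{m+1} = R_m` and put `T_m = p^{k+1} R_m`, so `T_0 = p^{k+1} Q` is rational, `p T_{m+1} = T_m`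
  and `T_{k+1} = Q`; the continuous crossed homomorphism `σ ↦ (σ T_m − T_m)_m ∈ T_pE = lim E[p^m]`
  has `(k+1)`-st component `σ Q − Q`, the local Kummer cocycle of `Q` at level `p^{k+1}`;
* `propagatedSelmerStructure_le_kummerSelmerStructure_of_bounded`:
  **`𝓕_can(E[p^{k+1}])_v ≤ 𝓛_v(p^{k+1})`** under hbd (p06's binder VERBATIM, now at any place) —
  p06's argument at level `k`: the image of `π_{k+1,*}[η]` in `H¹(ℚ_v, E)` is the class of
  `g ↦ (η g)_{k+1} = p^N •` the class of `g ↦ (η g)_{N+k+1}`, a `p^{N+k+1}`-torsion class, hence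
  killed by `p^N` (hbd);
* `propagatedSelmerStructure_eq_kummerSelmerStructure_of_bounded`: the equality.

Consumer: the sibling `PropagatedStructureUnramified.lean` (x11b's "Kummer = unramified at good
`v ∤ p`" ⟹ `𝓕_can` is `IsUnramifiedOutside S` for `S ⊇ ∞ ∪ {p} ∪ {bad}` modulo hbd = p13's `hunr`).
IMPORT LINEAGE (lead R5-22 / R5-29 (o): `PropagatedConditionKummer` (p18, decl of record) and
`PropagatedStructureKummer` (p13, p254000) share the FQN `kummerSelmerStructure_le_propagatedSelmerStructureOne`
and cannot be co-imported until p13's fix (A) re-lands; until then NO n1011 file imports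
`PropagatedStructureKummer`): this file imports NEITHER — only `PropagatedStructure` and the
Literature Kummer API — so it composes with both lineages now and after (A).  The inclusion
`𝓛_v(p^{k+1}) ≤ 𝓕_can,v` it needs IS p13's public theorem
`PropagatedStructureKummer.kummerSelmerStructure_le_propagatedSelmerStructure` (same statement); per the
gate's dedup guidance ("a `private` copy is acceptable for a local helper") it is re-proved here as
the PRIVATE helper `kummerSelmerStructure_pow_mul_le_propagatedSelmerStructure` (p18's construction,
shifted), not exported — cite p13's theorem for the public statement; after (A) the private copy
may be replaced by the import (proof-only change).  The level-one theorems are not restated.  hbd is kept here as an explicit binder at a GENERAL place `v` (it is genuine at `v = p` and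
`v = ∞`); at every finite `v ∤ p` it is a THEOREM of the tree — the sibling
`LocalH1TorsionBounded.lean` (`bounded_pPrimaryTorsion_localGaloisModule_rat`, from the tree's
prime-to-`p` local Euler–Poincaré characteristic `natCard_invariants_mul_natCard_two_eq`; Tate local
duality order form, Milne *ADT* I Cor. 3.4), fed in by `PropagatedStructureUnramified.lean`.

References: B. Mazur, K. Rubin, Mem. AMS 799 (2004) Def. 3.2.1, Lemma 3.7.1; K. Rubin, PCMS 18
(2011) §3.1 [Rubin2011]; R. Sakamoto, JTNB 36 (2024) Def. 3.5–3.8 [Sakamoto2024]; J. H. Silverman,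
*AEC* III.§7, VIII.§2, X.§4 [SilvermanAEC2009]; J. S. Milne, *ADT* I.§3, I.§6 [MilneADT2006].
-/

noncomputable section

open scoped Classical NumberField ContRepresentation
open Field NumberField IsDedekindDomain
open WeierstrassCurve Literature.NumberTheory.EllipticCurves Literature.NumberTheory.GaloisRepresentations
  Literature.NumberTheory.GaloisRepresentations.DiscreteGaloisModule

namespace Summit.BirchSwinnertonDyer.Rank1Residual.GaloisImage

variable (W : WeierstrassCurve ℚ) [W.IsElliptic] (p : ℕ) [hp : Fact p.Prime] (k : ℕ)

/-! ## §1. `𝓛_v(p^{k+1}) ≤ 𝓕_can(E[p^{k+1}])_v` — every local Kummer class lifts to `H¹(ℚ_v, T_pE)` -/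

/-- **Every local Kummer class of level `p^{k+1}` lifts to `H¹(ℚ_v, T_pE)`:
`κ_v(Q) ∈ 𝓕_can(E[p^{k+1}])_v`.**  For a place `v` of `ℚ` and `Q ∈ E(ℚ̄_v)` with
`p^{k+1} • Q ∈ E(ℚ_v)` (level spelled `p^k · p`), the local Kummer class
`κ_v(Q) = [σ ↦ σQ − Q] ∈ H¹(ℚ_v, E[p^{k+1}])` is `π_{k+1,*}` (`tateLocalMap`) of the class of the
continuous crossed homomorphism `σ ↦ (σ T_m − T_m)_m ∈ T_pE`, where `T_m = p^{k+1} • R_m` for a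
chosen sequence of `p`-power roots `R_0 = Q`, `p • R_{m+1} = R_m` (so `T_0 = p^{k+1} Q ∈ E(ℚ_v)`,
`p • T_{m+1} = T_m`, `T_{k+1} = Q`).  Every place, every reduction type.  The level-one case is
n1011-p18's `localKummerClass_mem_propagatedSelmerStructureOne` (same construction, unshifted); p13's
`PropagatedStructureKummer.lean` proves the same inclusion via `kummerLiftCocycle` (not importable
together with the p18/p06 lineage, lead R5-22 — hence re-proved, see the module docstring).
[cite: SilvermanAEC2009, VIII.§2 (the Kummer pairing) and III.§7] [cite: Rubin2011, §3.1 (p. 29)] -/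
private theorem localKummerClass_mem_propagatedSelmerStructure (v : Place ℚ)
    (Q : localPoints W (Place.Completion v))
    (hQ : ((p : ℤ) ^ k * (p : ℤ)) • Q ∈ MulAction.fixedPoints
      (absoluteGaloisGroup (Place.Completion v)) (localPoints W (Place.Completion v))) :
    W.localKummerClass ((p : ℤ) ^ k * (p : ℤ))
        (mul_ne_zero (pow_ne_zero _ (Int.natCast_ne_zero.mpr hp.out.ne_zero))
          (Int.natCast_ne_zero.mpr hp.out.ne_zero)) Q hQ ∈
      propagatedSelmerStructure W p k v := by
  set E := Place.Completion v with hE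
  have hp0 : (p : ℤ) ≠ 0 := Int.natCast_ne_zero.mpr hp.out.ne_zero
  have hn0 : ((p : ℤ) ^ k * (p : ℤ)) ≠ 0 := mul_ne_zero (pow_ne_zero _ hp0) hp0
  have hpow : ∀ m : ℕ, ((p : ℤ) ^ (m + 1)) ≠ 0 := fun m => pow_ne_zero _ hp0
  -- a chosen sequence of `p`-power roots of `Q` in the divisible group `E(ℚ̄_v)`
  have hroot : ∀ P : localPoints W E, ∃ P₁ : localPoints W E, (p : ℤ) • P₁ = P := fun P =>
    (W.baseChange (AlgebraicClosure E)).zsmul_surjective_of_isAlgClosed hp0 P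
  choose rt hrt using hroot
  let R : ℕ → localPoints W E := fun n => Nat.rec Q (fun _ P => rt P) n
  have hR0 : R 0 = Q := rfl
  have hRs : ∀ n, (p : ℤ) • R (n + 1) = R n := fun n => hrt (R n)
  have hRpow : ∀ n, ((p : ℤ) ^ n) • R n = Q := by
    intro n
    induction n with
    | zero => rw [pow_zero, one_smul]; exact hR0
    | succ n ih => rw [pow_succ, mul_smul, hRs, ih]
  -- the SHIFTED sequence `T_m = p^{k+1} • R_m`: `T_0 = p^{k+1} Q`, `p T_{m+1} = T_m`, `T_{k+1} = Q`
  -- (kept opaque: only the three relations below are used)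
  obtain ⟨T, hT⟩ : ∃ T : ℕ → localPoints W E, ∀ n, T n = ((p : ℤ) ^ k * (p : ℤ)) • R n :=
    ⟨fun n => ((p : ℤ) ^ k * (p : ℤ)) • R n, fun _ => rfl⟩
  have hTs : ∀ n, (p : ℤ) • T (n + 1) = T n := fun n => by
    rw [hT (n + 1), hT n, smul_comm, hRs]
  have hTk : T (k + 1) = Q := by
    rw [hT, ← pow_succ, hRpow]
  have hTfix : ∀ n, ((p : ℤ) ^ (n + 1)) • T (n + 1) ∈
      MulAction.fixedPoints (absoluteGaloisGroup E) (localPoints W E) := by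
    intro n
    rw [hT, smul_comm, hRpow (n + 1)]
    exact hQ
  -- the local Kummer cocycles `σ ↦ σ T_{m+1} − T_{m+1} ∈ E[p^{m+1}]` at every level
  let κ : ∀ m : ℕ, contOneCocycles
      (DiscreteGaloisModule.toTopRep
        (GaloisRep.restrictField E (W.torsionGaloisModule ((p : ℤ) ^ (m + 1))))) :=
    fun m => W.localKummerCocycle ((p : ℤ) ^ (m + 1)) (hpow m) (T (m + 1)) (hTfix m)
  have hκ : ∀ m σ, pointsMap W E ((κ m).1 σ : geomPoints W) = σ • T (m + 1) - T (m + 1) :=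
    fun m σ => W.pointsMap_localKummerCocycle_apply ((p : ℤ) ^ (m + 1)) (hpow m) (T (m + 1))
      (hTfix m) σ
  have hinj : Function.Injective (pointsMap W E) := pointsMapOfEmb_injective W (closureEmb (K := ℚ) E)
  -- the components of the `T_pE`-valued cocycle: `a σ 0 = 0`, `a σ (m+1) = σ T_{m+1} − T_{m+1}`
  let a : absoluteGaloisGroup E → ℕ → geomPoints W := fun σ n =>
    Nat.rec (motive := fun _ => geomPoints W) 0 (fun m _ => ((κ m).1 σ : geomPoints W)) n
  have ha0 : ∀ σ, a σ 0 = 0 := fun _ => rfl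
  have haS : ∀ σ m, a σ (m + 1) = ((κ m).1 σ : geomPoints W) := fun _ _ => rfl
  -- `p^n • a σ n = 0`
  have h1 : ∀ σ n, p ^ n • a σ n = 0 := by
    intro σ n
    cases n with
    | zero => rw [ha0, smul_zero]
    | succ m =>
      rw [haS, ← natCast_zsmul, Nat.cast_pow]
      exact (mem_geomTorsion_iff W _ _).mp ((κ m).1 σ).2
  -- `p • a σ (n+1) = a σ n`
  have h2 : ∀ σ n, p • a σ (n + 1) = a σ n := by
    intro σ n
    cases n with
    | zero =>
      rw [ha0, haS, ← natCast_zsmul]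
      have h := (mem_geomTorsion_iff W _ _).mp ((κ 0).1 σ).2
      have e : ((p : ℤ) ^ (0 + 1)) = (p : ℤ) := by rw [zero_add, pow_one]
      exact (congrArg (fun c : ℤ => c • ((κ 0).1 σ : geomPoints W)) e).symm.trans h
    | succ m =>
      rw [haS, haS, ← natCast_zsmul]
      apply hinj
      rw [map_zsmul, hκ, hκ, zsmul_sub, ← smul_zsmul_localPoints, hTs]
  -- the crossed homomorphism `η : Γ_{ℚ_v} → T_pE`
  let ηfun : absoluteGaloisGroup E → W.tateModule p := fun σ => TateModule.mk (a σ) (h1 σ) (h2 σ)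
  have hηproj0 : ∀ σ, TateModule.proj p 0 (ηfun σ) = 0 := fun σ => ha0 σ
  have hηprojS : ∀ σ m, TateModule.proj p (m + 1) (ηfun σ) = ((κ m).1 σ : geomPoints W) :=
    fun σ m => haS σ m
  have hηcont : Continuous ηfun := by
    refine continuous_induced_rng.mpr (continuous_pi fun n => ?_)
    cases n with
    | zero => exact continuous_const
    | succ m =>
      change Continuous fun σ => a σ (m + 1)
      simp only [haS]
      exact continuous_subtype_val.comp (κ m).1.continuous
  let η : contOneCocycles (tateLocalRep W p v).toTopRep :=
    ⟨⟨ηfun, hηcont⟩, fun g h => by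
      refine TateModule.ext fun n => ?_
      change TateModule.proj p n (ηfun (g * h)) =
        TateModule.proj p n (ηfun g + (tateLocalRep W p v).toTopRep.ρ g (ηfun h))
      rw [map_add, ContinuousRep.toTopRep_ρ_apply, tateLocalRep_apply_apply,
        TateModule.proj_smul_of_distribMulAction]
      cases n with
      | zero => rw [hηproj0, hηproj0, hηproj0, smul_zero, add_zero]
      | succ m =>
        rw [hηprojS, hηprojS, hηprojS]
        have hc : ((κ m).1 (g * h) : geomPoints W) =
            ((κ m).1 g : geomPoints W) + absGaloisRestrict ℚ E g • ((κ m).1 h : geomPoints W) :=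
          congrArg (fun P : geomTorsion W ((p : ℤ) ^ (m + 1)) => (P : geomPoints W)) ((κ m).2 g h)
        exact hc⟩
  -- `π_{k+1} ∘ η` is the level-`p^{k+1}` local Kummer cocycle of `Q` (compare underlying points)
  have hpush : pushCocycle W p k v η = W.localKummerCocycle ((p : ℤ) ^ k * (p : ℤ)) hn0 Q hQ := by
    refine Subtype.ext (ContinuousMap.ext fun g => Subtype.ext (hinj ?_))
    change pointsMap W E (TateModule.proj p (k + 1) (ηfun g)) =
      pointsMap W E ((W.localKummerCocycle ((p : ℤ) ^ k * (p : ℤ)) hn0 Q hQ).1 g : geomPoints W)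
    rw [W.pointsMap_localKummerCocycle_apply, hηprojS g k, hκ, hTk]
  refine (mem_propagatedSelmerStructure_iff W p k v _).mpr
    ⟨oneCocycleClass (tateLocalRep W p v).toTopRep η, ?_⟩
  rw [tateLocalMap_oneCocycleClass, hpush]
  rfl

/-- **`𝓛_v(p^{k+1}) ≤ 𝓕_can(E[p^{k+1}])_v` at every place**: the local Kummer condition on
`E[p^{k+1}]` (image of `E(ℚ_v)/p^{k+1}`, `WeierstrassCurve.kummerSelmerStructure ((p:ℤ)^k * p)`) is
contained in the propagated canonical condition `im(H¹(ℚ_v, T_pE) → H¹(ℚ_v, E[p^{k+1}]))`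
(`propagatedSelmerStructure W p k`), for every place `v` of `ℚ`, with NO hypothesis.  Local Kummer
classes are `κ_v(Q)` (`mem_kummerLocalConditionAt_iff_exists_eq_localKummerClass`) and those lift by
`localKummerClass_mem_propagatedSelmerStructure`.  Level-one sibling: n1011-p18's
`kummerSelmerStructure_le_propagatedSelmerStructureOne`; SAME STATEMENT as p13's
`PropagatedStructureKummer.kummerSelmerStructure_le_propagatedSelmerStructure` (p254000), re-proved on
a lineage-neutral import set (R5-22).
[cite: Rubin2011, §3.1 (p. 29)] [cite: Sakamoto2024, Def. 3.6 (p. 923)] -/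
private theorem kummerSelmerStructure_pow_mul_le_propagatedSelmerStructure (v : Place ℚ) :
    W.kummerSelmerStructure ((p : ℤ) ^ k * (p : ℤ)) v ≤ propagatedSelmerStructure W p k v := by
  intro x hx
  obtain ⟨Q, hQ, rfl⟩ := (W.mem_kummerLocalConditionAt_iff_exists_eq_localKummerClass
    ((p : ℤ) ^ k * (p : ℤ)) (E := Place.Completion v)
    (mul_ne_zero (pow_ne_zero _ (Int.natCast_ne_zero.mpr hp.out.ne_zero))
      (Int.natCast_ne_zero.mpr hp.out.ne_zero)) x).mp hx
  exact localKummerClass_mem_propagatedSelmerStructure W p k v Q hQ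

/-! ## §2. `𝓕_can(E[p^{k+1}])_v ≤ 𝓛_v(p^{k+1})` under bounded `p`-power torsion of `H¹(ℚ_v, E)` -/

/-- **`𝓕_can(E[p^{k+1}])_v ≤ 𝓛_v(p^{k+1})` at a place with bounded `p`-power torsion in
`H¹(ℚ_v, E)`.**  For `x = π_{k+1,*}[η] ∈ 𝓕_can(E[p^{k+1}])_v` (`η : Γ_{ℚ_v} → T_pE` a continuous
crossed homomorphism), the image of `x` in `H¹(ℚ_v, E(ℚ̄_v))` is the class of `g ↦ (η g)_{k+1}`,
which is `p^N •` the class of `g ↦ (η g)_{N+k+1}` (`p^N • a_{N+k+1} = a_{k+1}` on `T_pE`,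
`TateModule.pow_smul_proj_self_add`), a `p^{N+k+1}`-torsion class, hence `0` by `hbd`; so `x` lies in
the local Kummer condition.  `hbd` is n1011-p06's (Lℓ) binder verbatim, kept at a general
place `v` (a THEOREM at every finite `v ∤ p`: `bounded_pPrimaryTorsion_localGaloisModule_rat`,
`LocalH1TorsionBounded.lean`; Tate local duality order form, Milne *ADT* I Cor. 3.4).  Level-one sibling:
p06's `propagatedSelmerStructureOne_le_kummerSelmerStructure_inr`.
[cite: Rubin2011, §3.1 (p. 29)] [cite: SilvermanAEC2009, III.§7 and X.§4] -/
theorem propagatedSelmerStructure_le_kummerSelmerStructure_of_bounded (v : Place ℚ)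
    (hbd : ∃ N : ℕ, ∀ c : galoisCohomology (W.localGaloisModule (Place.Completion v)) 1,
      (∃ j : ℕ, ((p ^ j : ℕ) : ℤ) • c = 0) → ((p ^ N : ℕ) : ℤ) • c = 0) :
    propagatedSelmerStructure W p k v ≤ W.kummerSelmerStructure ((p : ℤ) ^ k * (p : ℤ)) v := by
  set E := Place.Completion v with hE
  obtain ⟨N, hN⟩ := hbd
  intro x hx
  -- `x = π_{k+1,*}[η]`
  obtain ⟨y, rfl⟩ := (mem_propagatedSelmerStructure_iff W p k v x).mp hx
  obtain ⟨η, rfl⟩ := oneCocycleClass_surjective (tateLocalRep W p v).toTopRep y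
  rw [tateLocalMap_oneCocycleClass]
  -- the goal lives in `𝓛_E = ker (H¹(Γ_E, E[p^{k+1}]) → H¹(Γ_E, E(ℚ̄_v)))`, `E = ℚ_v`
  refine (W.mem_kummerLocalConditionAt_iff ((p : ℤ) ^ k * (p : ℤ)) E _).mpr ?_
  have hmap := W.map_torsionPointsMapIntertwining_oneCocycleClass ((p : ℤ) ^ k * (p : ℤ)) E
    (pushCocycle W p k v η)
  erw [hmap]
  -- the two cocycles `g ↦ (η g)_{k+1}` and `g ↦ (η g)_{N+k+1}` with values in `E(ℚ̄_v)`
  set Y : TopRep ℤ (absoluteGaloisGroup E) := discreteTopRep (absoluteGaloisGroup E) (localPoints W E)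
    with hY
  set ψk := contOneCocycles.pullback (ContinuousMonoidHom.id (absoluteGaloisGroup E))
      (X := DiscreteGaloisModule.toTopRep
        (GaloisRep.restrictField E (W.torsionGaloisModule ((p : ℤ) ^ k * (p : ℤ)))))
      (Y := Y)
      (TopRep.ofHom ⟨(W.torsionPointsMapIntertwining ((p : ℤ) ^ k * (p : ℤ)) E).toContinuousLinearMap,
        (W.torsionPointsMapIntertwining ((p : ℤ) ^ k * (p : ℤ)) E).isIntertwining'⟩)
      (pushCocycle W p k v η)
    with hψk
  set ψN := contOneCocycles.pullback (ContinuousMonoidHom.id (absoluteGaloisGroup E))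
      (X := DiscreteGaloisModule.toTopRep
        (GaloisRep.restrictField E (W.torsionGaloisModule ((p : ℤ) ^ (N + k) * (p : ℤ)))))
      (Y := Y)
      (TopRep.ofHom ⟨(W.torsionPointsMapIntertwining ((p : ℤ) ^ (N + k) * (p : ℤ)) E).toContinuousLinearMap,
        (W.torsionPointsMapIntertwining ((p : ℤ) ^ (N + k) * (p : ℤ)) E).isIntertwining'⟩)
      (pushCocycle W p (N + k) v η)
    with hψN
  have hψk_apply : ∀ g, ψk.1 g = pointsMap W E (TateModule.proj p (k + 1) (η.1 g)) := fun g => rfl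
  have hψN_apply : ∀ g, ψN.1 g = pointsMap W E (TateModule.proj p (N + k + 1) (η.1 g)) :=
    fun g => rfl
  -- `ψk = p^N • ψN` (`p^N • a_{N+(k+1)} = a_{k+1}`; `N + (k+1)` and `N + k + 1` agree definitionally)
  have hrel : ψk = ((p ^ N : ℕ) : ℤ) • ψN := by
    refine Subtype.ext (ContinuousMap.ext fun g => ?_)
    change ψk.1 g = ((p ^ N : ℕ) : ℤ) • ψN.1 g
    rw [hψk_apply, hψN_apply, ← map_zsmul, natCast_zsmul]
    congr 1
    exact (TateModule.pow_smul_proj_self_add N (k + 1) (η.1 g)).symm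
  -- `p^{N+k+1} • ψN = 0` (values in `E[p^{N+k+1}]`), hence `p^{N+k+1} • [ψN] = 0`
  have h0 : ((p ^ (N + k + 1) : ℕ) : ℤ) • ψN = 0 := by
    refine Subtype.ext (ContinuousMap.ext fun g => ?_)
    change ((p ^ (N + k + 1) : ℕ) : ℤ) • ψN.1 g = 0
    rw [hψN_apply, ← map_zsmul]
    have hmem := proj_succ_mem_geomTorsion W p (N + k) (η.1 g)
    rw [mem_geomTorsion_iff, ← pow_succ, ← Nat.cast_pow] at hmem
    rw [hmem, map_zero]
  -- the `ℤ`-module scalar action on classes (`oneCocycleClass_smul`) vs the group `zsmul` of `hbd`: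
  -- `int_smul_eq_zsmul`
  have hmodN : _ := congrArg (oneCocycleClass Y) h0
  rw [oneCocycleClass_smul, oneCocycleClass_zero] at hmodN
  have htors : ((p ^ (N + k + 1) : ℕ) : ℤ) • oneCocycleClass Y ψN = 0 :=
    (int_smul_eq_zsmul (continuousCohomology 1 Y).toModuleCat.isModule _ _).symm.trans hmodN
  -- hence `p^N • [ψN] = 0` by `hbd`
  have hkill : ((p ^ N : ℕ) : ℤ) • oneCocycleClass Y ψN = 0 :=
    hN (oneCocycleClass Y ψN) ⟨N + k + 1, htors⟩
  -- and `[ψk] = p^N • [ψN] = 0`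
  have hmodk : _ := congrArg (oneCocycleClass Y) hrel
  rw [oneCocycleClass_smul] at hmodk
  rw [hmodk]
  exact (int_smul_eq_zsmul (continuousCohomology 1 Y).toModuleCat.isModule _ _).trans hkill

/-- **`𝓕_can(E[p^{k+1}])_v = 𝓛_v(p^{k+1})`** under the same binder hbd: the two inclusions
`propagatedSelmerStructure_le_kummerSelmerStructure_of_bounded` and
`kummerSelmerStructure_pow_mul_le_propagatedSelmerStructure`.  Level-one sibling: p06's
`propagatedSelmerStructureOne_inr_eq_kummerSelmerStructure`.
[cite: Rubin2011, §3.1 (p. 29)] [cite: Sakamoto2024, Def. 3.6 (p. 923)] -/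
theorem propagatedSelmerStructure_eq_kummerSelmerStructure_of_bounded (v : Place ℚ)
    (hbd : ∃ N : ℕ, ∀ c : galoisCohomology (W.localGaloisModule (Place.Completion v)) 1,
      (∃ j : ℕ, ((p ^ j : ℕ) : ℤ) • c = 0) → ((p ^ N : ℕ) : ℤ) • c = 0) :
    propagatedSelmerStructure W p k v = W.kummerSelmerStructure ((p : ℤ) ^ k * (p : ℤ)) v :=
  le_antisymm (propagatedSelmerStructure_le_kummerSelmerStructure_of_bounded W p k v hbd)
    (kummerSelmerStructure_pow_mul_le_propagatedSelmerStructure W p k v)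

end Summit.BirchSwinnertonDyer.Rank1Residual.GaloisImage

end
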